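import Summits.QuantumFields.YangMills.Theorems.SmallCircleAnchorAnchorGapStubDebyeScreening19

/-!
# Crux `AnchorGap` (stmt-QuantumFields-11141), line `registered` — block decoupling of Gaussian integrals (B1/B2 under stub X₀)

The `s = 0` end and the positivity bookkeeping of one Glimm–Jaffe–Spencer decoupling step in
precision-matrix form.  For a finite index set `ι`, a set `S` of coordinates and a precision
matrix `P`, write `P_bd` for the block-diagonal part of `P` along `S ⊔ Sᶜ` (entries between `S`
and `Sᶜ` set to zero; written inline with `Matrix.of`):

* `posDef_blockDiag` — `P` positive definite ⇒ `P_bd` positive definite;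
* `posDef_blockDiag_interpolate` — `P_bd + s (P − P_bd)` is positive definite for `s ∈ [0,1]`;
* `gaussian_integral_factorizes` — for a block-diagonal `Q` and observables `F`, `G` depending
  only on the `S`- (resp. `Sᶜ`-) coordinates, `(∫ F G e^{−½φᵀQφ})(∫ e^{−½φᵀQφ}) = (∫ F e^{−½φᵀQφ})(∫ G e^{−½φᵀQφ})`
  (independence of the two blocks under the decoupled Gaussian: Fubini along
  `MeasurableEquiv.piEquivPiSubtypeProd`);
* `gaussian_decoupling_step` — **one decoupling step**:
  `⟨F⟩_P − ⟨F⟩_{P_bd} = ∫₀¹ (−½) Σ_{a,b} (C_s (P − P_bd) C_s)_{ab} ⟨∂_b∂_a F⟩_{P_bd + s(P−P_bd)} ds`,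
  `C_s = (P_bd + s(P − P_bd))⁻¹` (`gaussian_interpolation` along the positive segment).

Iterating the step over a growing family of decoupled regions and factorising the `s = 0` ends is
the inductive decoupling expansion of Brydges 1978 §3, (3.14)–(3.17).
-/

set_option autoImplicit false

noncomputable section

namespace Summit.QuantumFields.YangMills.Theorems.AnchorGap

open MeasureTheory Finset Matrix

/-- **The block-diagonal part of a positive definite matrix is positive definite**: for
`P_bd(i,j) = P(i,j)` if `i, j` lie on the same side of `S` and `0` otherwise,
`xᵀ P_bd x = x_Sᵀ P x_S + x_{Sᶜ}ᵀ P x_{Sᶜ} > 0` for `x ≠ 0`. [folklore] -/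
theorem posDef_blockDiag :
    ∀ (ι : Type) [Fintype ι] [DecidableEq ι] (P : Matrix ι ι ℝ), P.PosDef → ∀ S : Finset ι, (Matrix.of fun i j : ι => if (i ∈ S ↔ j ∈ S) then P i j else 0).PosDef := by
  intro ι _ _ P hP S
  have hsymm : P.IsSymm := Matrix.isHermitian_iff_isSymm.1 hP.isHermitian
  have hPij : ∀ i j, P i j = P j i := fun i j => by
    have := congrFun (congrFun hsymm.eq j) i
    rwa [Matrix.transpose_apply] at this
  -- restriction of a vector to `S` / to `Sᶜ`
  have hform : ∀ x : ι → ℝ, x ⬝ᵥ ((Matrix.of fun i j : ι => if (i ∈ S ↔ j ∈ S) then P i j else 0) *ᵥ x) =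
      (fun i => if i ∈ S then x i else 0) ⬝ᵥ (P *ᵥ fun i => if i ∈ S then x i else 0) +
        (fun i => if i ∈ S then 0 else x i) ⬝ᵥ (P *ᵥ fun i => if i ∈ S then 0 else x i) := by
    intro x
    simp only [dotProduct, Matrix.mulVec, Matrix.of_apply, ← Finset.sum_add_distrib]
    refine Finset.sum_congr rfl fun i _ => ?_
    rw [Finset.mul_sum, Finset.mul_sum, Finset.mul_sum, ← Finset.sum_add_distrib]
    refine Finset.sum_congr rfl fun j _ => ?_
    by_cases hi : i ∈ S <;> by_cases hj : j ∈ S <;> simp [hi, hj]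
  refine Matrix.PosDef.of_dotProduct_mulVec_pos ?_ fun x hx => ?_
  · refine Matrix.isHermitian_iff_isSymm.2 (Matrix.IsSymm.ext fun i j => ?_)
    simp only [Matrix.of_apply]
    rw [hPij j i]
    by_cases hi : i ∈ S <;> by_cases hj : j ∈ S <;> simp [hi, hj]
  · simp only [star_trivial]
    rw [hform x]
    have h1 := hP.posSemidef.dotProduct_mulVec_nonneg (fun i => if i ∈ S then x i else 0)
    have h2 := hP.posSemidef.dotProduct_mulVec_nonneg (fun i => if i ∈ S then 0 else x i)
    simp only [star_trivial] at h1 h2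
    -- one of the two restrictions is non-zero
    obtain ⟨i₀, hi₀⟩ : ∃ i, x i ≠ 0 := Function.ne_iff.1 hx
    by_cases hmem : i₀ ∈ S
    · have hne : (fun i => if i ∈ S then x i else 0) ≠ 0 := by
        intro h; have := congrFun h i₀; simp [hmem] at this; exact hi₀ this
      have := hP.dotProduct_mulVec_pos hne
      simp only [star_trivial] at this
      linarith
    · have hne : (fun i => if i ∈ S then (0 : ℝ) else x i) ≠ 0 := by
        intro h; have := congrFun h i₀; simp [hmem] at this; exact hi₀ this
      have := hP.dotProduct_mulVec_pos hne
      simp only [star_trivial] at this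
      linarith

/-- **The segment from the block-diagonal part to the matrix stays positive definite**:
`P_bd + s (P − P_bd)` is positive definite for `0 ≤ s ≤ 1` (convex combination of `P_bd` and
`P`). [folklore] -/
theorem posDef_blockDiag_interpolate :
    ∀ (ι : Type) [Fintype ι] [DecidableEq ι] (P : Matrix ι ι ℝ), P.PosDef → ∀ (S : Finset ι) (s : ℝ), 0 ≤ s → s ≤ 1 → ((Matrix.of fun i j : ι => if (i ∈ S ↔ j ∈ S) then P i j else 0) + s • (P - Matrix.of fun i j : ι => if (i ∈ S ↔ j ∈ S) then P i j else 0)).PosDef := by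
  intro ι _ _ P hP S s hs0 hs1
  have hbd := posDef_blockDiag ι P hP S
  set Pbd : Matrix ι ι ℝ := Matrix.of fun i j : ι => if (i ∈ S ↔ j ∈ S) then P i j else 0 with hPbd
  rcases eq_or_lt_of_le hs0 with h0 | h0
  · rw [← h0, zero_smul, add_zero]; exact hbd
  rcases eq_or_lt_of_le hs1 with h1 | h1
  · rw [h1, one_smul, add_sub_cancel]; exact hP
  have : Pbd + s • (P - Pbd) = (1 - s) • Pbd + s • P := by
    rw [smul_sub, sub_smul, one_smul]; abel
  rw [this]
  exact (hbd.smul (by linarith)).add (hP.smul h0)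

/-- Fubini for block-diagonal Gaussian weights: an `S`-local factor times an `Sᶜ`-local factor
integrates to the product of the two block integrals. -/
private lemma factor_aux {ι : Type} [Fintype ι] [DecidableEq ι] (Q : Matrix ι ι ℝ) (S : Finset ι)
    (hQ : ∀ i j : ι, ¬ (i ∈ S ↔ j ∈ S) → Q i j = 0) (H₁ H₂ : (ι → ℝ) → ℝ)
    (h₁ : ∀ φ ψ : ι → ℝ, (∀ i ∈ S, φ i = ψ i) → H₁ φ = H₁ ψ)
    (h₂ : ∀ φ ψ : ι → ℝ, (∀ i, i ∉ S → φ i = ψ i) → H₂ φ = H₂ ψ) :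
    ∫ φ : ι → ℝ, H₁ φ * H₂ φ * Real.exp (-(φ ⬝ᵥ (Q *ᵥ φ)) / 2) =
      (∫ u : {i // i ∈ S} → ℝ, H₁ (fun i => if h : i ∈ S then u ⟨i, h⟩ else 0) *
          Real.exp (-((fun i => if h : i ∈ S then u ⟨i, h⟩ else 0) ⬝ᵥ
            (Q *ᵥ fun i => if h : i ∈ S then u ⟨i, h⟩ else 0)) / 2)) *
        ∫ v : {i // ¬ i ∈ S} → ℝ, H₂ (fun i => if h : i ∈ S then 0 else v ⟨i, h⟩) *
          Real.exp (-((fun i => if h : i ∈ S then 0 else v ⟨i, h⟩) ⬝ᵥ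
            (Q *ᵥ fun i => if h : i ∈ S then 0 else v ⟨i, h⟩)) / 2) := by
  set e := MeasurableEquiv.piEquivPiSubtypeProd (fun _ : ι => ℝ) (fun i => i ∈ S) with he
  have hmp : MeasurePreserving e volume volume := by
    have := volume_preserving_piEquivPiSubtypeProd (fun _ : ι => ℝ) (fun i => i ∈ S)
    convert this using 2
    all_goals (congr; try exact Subsingleton.elim _ _)
  have he_symm : ∀ (z : ({i // i ∈ S} → ℝ) × ({i // ¬ i ∈ S} → ℝ)) (i : ι),
      e.symm z i = if h : i ∈ S then z.1 ⟨i, h⟩ else z.2 ⟨i, h⟩ := by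
    intro z i
    simp only [he, MeasurableEquiv.piEquivPiSubtypeProd, MeasurableEquiv.symm_mk, MeasurableEquiv.coe_mk,
      Equiv.piEquivPiSubtypeProd_symm_apply]
  -- the two partial extensions by zero
  set X₁ : ({i // i ∈ S} → ℝ) → (ι → ℝ) := fun u i => if h : i ∈ S then u ⟨i, h⟩ else 0 with hX₁
  set X₂ : ({i // ¬ i ∈ S} → ℝ) → (ι → ℝ) := fun v i => if h : i ∈ S then 0 else v ⟨i, h⟩ with hX₂
  have hsplit : ∀ z : ({i // i ∈ S} → ℝ) × ({i // ¬ i ∈ S} → ℝ), e.symm z = X₁ z.1 + X₂ z.2 := by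
    intro z; funext i
    rw [he_symm, Pi.add_apply, hX₁, hX₂]
    by_cases h : i ∈ S <;> simp [h]
  have hH₁ : ∀ z : ({i // i ∈ S} → ℝ) × ({i // ¬ i ∈ S} → ℝ), H₁ (e.symm z) = H₁ (X₁ z.1) := fun z =>
    h₁ _ _ fun i hi => by rw [he_symm, hX₁]; simp [hi]
  have hH₂ : ∀ z : ({i // i ∈ S} → ℝ) × ({i // ¬ i ∈ S} → ℝ), H₂ (e.symm z) = H₂ (X₂ z.2) := fun z =>
    h₂ _ _ fun i hi => by rw [he_symm, hX₂]; simp [hi]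
  -- the cross terms of the quadratic form vanish
  have hcross₁ : ∀ (u : {i // i ∈ S} → ℝ) (v : {i // ¬ i ∈ S} → ℝ), X₁ u ⬝ᵥ (Q *ᵥ X₂ v) = 0 := by
    intro u v
    simp only [dotProduct, Matrix.mulVec]
    refine Finset.sum_eq_zero fun i _ => ?_
    by_cases hi : i ∈ S
    · rw [Finset.sum_eq_zero fun j _ => ?_, mul_zero]
      by_cases hj : j ∈ S
      · simp [hX₂, hj]
      · rw [hQ i j (by simp [hi, hj]), zero_mul]
    · simp [hX₁, hi]
  have hcross₂ : ∀ (u : {i // i ∈ S} → ℝ) (v : {i // ¬ i ∈ S} → ℝ), X₂ v ⬝ᵥ (Q *ᵥ X₁ u) = 0 := by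
    intro u v
    simp only [dotProduct, Matrix.mulVec]
    refine Finset.sum_eq_zero fun i _ => ?_
    by_cases hi : i ∈ S
    · simp [hX₂, hi]
    · rw [Finset.sum_eq_zero fun j _ => ?_, mul_zero]
      by_cases hj : j ∈ S
      · rw [hQ i j (by simp [hi, hj]), zero_mul]
      · simp [hX₁, hj]
  have hquad : ∀ z : ({i // i ∈ S} → ℝ) × ({i // ¬ i ∈ S} → ℝ),
      e.symm z ⬝ᵥ (Q *ᵥ e.symm z) = X₁ z.1 ⬝ᵥ (Q *ᵥ X₁ z.1) + X₂ z.2 ⬝ᵥ (Q *ᵥ X₂ z.2) := by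
    intro z
    rw [hsplit z, Matrix.mulVec_add, add_dotProduct, dotProduct_add, dotProduct_add, hcross₁, hcross₂]
    ring
  -- change variables and apply Fubini
  have h1 : ∫ φ : ι → ℝ, H₁ φ * H₂ φ * Real.exp (-(φ ⬝ᵥ (Q *ᵥ φ)) / 2) =
      ∫ z, H₁ (e.symm z) * H₂ (e.symm z) * Real.exp (-(e.symm z ⬝ᵥ (Q *ᵥ e.symm z)) / 2) := by
    rw [← hmp.symm.integral_comp' (g := fun φ => H₁ φ * H₂ φ * Real.exp (-(φ ⬝ᵥ (Q *ᵥ φ)) / 2))]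
  rw [h1, Measure.volume_eq_prod]
  have h2 : ∀ z : ({i // i ∈ S} → ℝ) × ({i // ¬ i ∈ S} → ℝ),
      H₁ (e.symm z) * H₂ (e.symm z) * Real.exp (-(e.symm z ⬝ᵥ (Q *ᵥ e.symm z)) / 2) =
        (H₁ (X₁ z.1) * Real.exp (-(X₁ z.1 ⬝ᵥ (Q *ᵥ X₁ z.1)) / 2)) *
          (H₂ (X₂ z.2) * Real.exp (-(X₂ z.2 ⬝ᵥ (Q *ᵥ X₂ z.2)) / 2)) := by
    intro z
    rw [hH₁, hH₂, hquad, neg_add, add_div, Real.exp_add]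
    ring
  simp_rw [h2]
  exact integral_prod_mul (μ := (volume : Measure ({i // i ∈ S} → ℝ)))
    (ν := (volume : Measure ({i // ¬ i ∈ S} → ℝ)))
    (fun u => H₁ (X₁ u) * Real.exp (-(X₁ u ⬝ᵥ (Q *ᵥ X₁ u)) / 2))
    (fun v => H₂ (X₂ v) * Real.exp (-(X₂ v ⬝ᵥ (Q *ᵥ X₂ v)) / 2))

/-- **Independence of decoupled blocks.** If the precision matrix `Q` has no entries between `S`
and `Sᶜ`, and `F` depends only on the coordinates in `S`, `G` only on those outside `S`, then
`(∫ F G e^{−½φᵀQφ})(∫ e^{−½φᵀQφ}) = (∫ F e^{−½φᵀQφ})(∫ G e^{−½φᵀQφ})`, i.e.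
`⟨F G⟩_Q = ⟨F⟩_Q ⟨G⟩_Q`: the `s = 0` end of a decoupling step factorises (Fubini along the
splitting `(ι → ℝ) ≃ (S → ℝ) × (Sᶜ → ℝ)`; no integrability hypotheses). [folklore] -/
theorem gaussian_integral_factorizes :
    ∀ (ι : Type) [Fintype ι] [DecidableEq ι] (Q : Matrix ι ι ℝ) (S : Finset ι), (∀ i j : ι, ¬ (i ∈ S ↔ j ∈ S) → Q i j = 0) → ∀ (F G : (ι → ℝ) → ℝ), (∀ φ ψ : ι → ℝ, (∀ i ∈ S, φ i = ψ i) → F φ = F ψ) → (∀ φ ψ : ι → ℝ, (∀ i, i ∉ S → φ i = ψ i) → G φ = G ψ) → (∫ φ : ι → ℝ, F φ * G φ * Real.exp (-(φ ⬝ᵥ (Q *ᵥ φ)) / 2)) * (∫ φ : ι → ℝ, Real.exp (-(φ ⬝ᵥ (Q *ᵥ φ)) / 2)) = (∫ φ : ι → ℝ, F φ * Real.exp (-(φ ⬝ᵥ (Q *ᵥ φ)) / 2)) * (∫ φ : ι → ℝ, G φ * Real.exp (-(φ ⬝ᵥ (Q *ᵥ φ)) / 2)) := by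
  intro ι _ _ Q S hQ F G hF hG
  have hFG := factor_aux Q S hQ F G hF hG
  have h11 := factor_aux Q S hQ (fun _ => 1) (fun _ => 1) (fun _ _ _ => rfl) (fun _ _ _ => rfl)
  have hF1 := factor_aux Q S hQ F (fun _ => 1) hF (fun _ _ _ => rfl)
  have h1G := factor_aux Q S hQ (fun _ => 1) G (fun _ _ _ => rfl) hG
  simp only [one_mul, mul_one] at hFG h11 hF1 h1G
  rw [hFG, h11, hF1, h1G]
  ring

/-- **One decoupling step (Glimm–Jaffe–Spencer, precision form).** For a positive definite `P`, a
set `S` of coordinates, `P_bd` the block-diagonal part of `P` along `S ⊔ Sᶜ`, `D = P − P_bd` the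
coupling across `∂S`, and `F` in the polynomial-growth class with first and second coordinate
partial derivatives in the same class:
`⟨F⟩_P − ⟨F⟩_{P_bd} = ∫₀¹ (−½) Σ_{a,b} (C_s D C_s)_{ab} ⟨∂_b∂_a F⟩_{P_bd + sD} ds`, `C_s = (P_bd + sD)⁻¹`;
the `s = 0` expectation factorises over the two blocks (`gaussian_integral_factorizes`) and each
`s`-derivative produces one coupling entry `D_{pq}` across `∂S` with two covariance legs
`C_s(a,p)`, `C_s(q,b)`. [cite: Brydges1978, §3 (3.13)–(3.17)] -/
theorem gaussian_decoupling_step :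
    ∀ (ι : Type) [Fintype ι] [DecidableEq ι] (P : Matrix ι ι ℝ), P.PosDef → ∀ (S : Finset ι) (m : ℕ) (K : ℝ) (F : (ι → ℝ) → ℝ) (F₁ : ι → (ι → ℝ) → ℝ) (F₂ : ι → ι → (ι → ℝ) → ℝ), AEStronglyMeasurable F volume → (∀ a : ι, AEStronglyMeasurable (F₁ a) volume) → (∀ a b : ι, AEStronglyMeasurable (F₂ a b) volume) → (∀ φ : ι → ℝ, |F φ| ≤ K * (1 + ∑ i, φ i ^ 2) ^ m) → (∀ (a : ι) (φ : ι → ℝ), |F₁ a φ| ≤ K * (1 + ∑ i, φ i ^ 2) ^ m) → (∀ (a b : ι) (φ : ι → ℝ), |F₂ a b φ| ≤ K * (1 + ∑ i, φ i ^ 2) ^ m) → (∀ (a : ι) (φ : ι → ℝ), HasDerivAt (fun t : ℝ => F (Function.update φ a t)) (F₁ a φ) (φ a)) → (∀ (a b : ι) (φ : ι → ℝ), HasDerivAt (fun t : ℝ => F₁ a (Function.update φ b t)) (F₂ a b φ) (φ b)) → let Pbd : Matrix ι ι ℝ := Matrix.of fun i j : ι => if (i ∈ S ↔ j ∈ S)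 then P i j else 0; (∫ φ : ι → ℝ, F φ * Real.exp (-(φ ⬝ᵥ (P *ᵥ φ)) / 2)) / (∫ φ : ι → ℝ, Real.exp (-(φ ⬝ᵥ (P *ᵥ φ)) / 2)) - (∫ φ : ι → ℝ, F φ * Real.exp (-(φ ⬝ᵥ (Pbd *ᵥ φ)) / 2)) / (∫ φ : ι → ℝ, Real.exp (-(φ ⬝ᵥ (Pbd *ᵥ φ)) / 2)) = ∫ s in (0 : ℝ)..1, -(1 / 2) * ∑ a : ι, ∑ b : ι, ((Pbd + s • (P - Pbd))⁻¹ * (P - Pbd) * (Pbd + s • (P - Pbd))⁻¹) a b * ((∫ φ : ι → ℝ, F₂ a b φ * Real.exp (-(φ ⬝ᵥ ((Pbd + s • (P - Pbd)) *ᵥ φ)) / 2)) / ∫ φ : ι → ℝ, Real.exp (-(φ ⬝ᵥ ((Pbd + s • (P - Pbd)) *ᵥ φ)) / 2)) := by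
  intro ι _ _ P hP S m K F F₁ F₂ hFm hF₁m hF₂m hFb hF₁b hF₂b hderiv hderiv₂ Pbd
  have hbd : Pbd.PosDef := posDef_blockDiag ι P hP S
  have hend : (Pbd + (P - Pbd)).PosDef := by rw [add_sub_cancel]; exact hP
  have h := gaussian_interpolation ι Pbd (P - Pbd) hbd hend m K F F₁ F₂ hFm hF₁m hF₂m hFb hF₁b hF₂b hderiv hderiv₂
  rw [add_sub_cancel] at h
  exact h

end Summit.QuantumFields.YangMills.Theorems.AnchorGap

end
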